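import Summits.ABC.StewartYu.RecordExitCGeneric
import HarnessLib

/-!
# Exit C of the Gen-3 record on the CAPPED letters, I: the slack function and the four scalar comparisons
# (archimedean one-stage record `ArchG3Rec`, clause (C) of `RecordArchW`; plan R41; seat p4 g10, r2 line `arch-g3-frame`)

`Summits/ABC/StewartYu/RecordExitCCappedKeys.lean` — cell `abc-stewartyu`, route `YuMatveevShapeRat`, crux r2 `ArchCoreRat`
(stmt-ABC-20502). One plain definition (the slack function `Yslack`) and theorems; no named facts.  Sequel:
`RecordExitCCapped.lean` (the heavy/light split inside a column selection and clause (C) itself).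

On the capped letters (`Dⱼ ≤ ρ/Aⱼ + 1`, box scale `L = 2^{n+22}·u` with `2ρ ≤ u`, `16(n+1)L ≤ (S₀+1)(n+2)⁴`,
`2^{n+23}X ≤ 2X_f+1`, `64(n+1) ≤ X`, `D₀ ≤ XL/2`, `D₀ ≤ 8X·c_K·Ω`, `3(n+1)L ≤ 2c_K·X·Ω`, `2^{n+18} ≤ c_K`; for the record
`c_K = C_bⁿ·K`) clause (C) reduces — once the matrix is removed by `RecordExits.exitC_det_le` and the product
`∏ᵢ D(κ i)A(κ i)` is bounded by `(2ρ)^{r−1}·Ω` (HEAVY selection) or `(2ρ)ʳ` (LIGHT selection) — to four scalar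
comparisons, proved here in the subtraction-free parametrisation `r = s+1`, `n = s+2+t`:
`keyH1`, `keyH0`, `keyL1`, `keyL0` (heavy/light × `d₀ = 1/0`).  With the slack function
`Yslack c_K n r = (16(n+1))ʳ·(2^{n+21})ʳ·2^{n+20}·(n−r)!/((r!)³·nʳ·(n+1)!·(n+2)^{4r}·c_K)` the light `d₀ = 0` comparison is
an identity and the other three hold with the margins `3r(n−r+1)(n+2)⁴/4`, `X·r(n−r+1)(n+2)⁴c_K/((n+1)2^{n+23})`,
`c_K/2^{n+18}`.  NO logarithmic (5.22) line, no `hcorner`.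

WHAT THIS IS NOT: no choice of the record's letters (p1's `ArchG3Rec`), no clause (N) numerics; no crux moves.

## References
* [Nesterenko2003] Yu. V. Nesterenko, LNM 1819 (2003) — §5.2 (5.13), (5.19)–(5.22), Lemmas 5.3–5.4 (pp. 99–106).
* [Matveev2000] E. M. Matveev, Izv. Math. 64 (2000) — (1.3) (the pivot-weighted covolume currency).
-/

noncomputable section

open Finset Real Nat

namespace Summit.ABC.StewartYu.RecordExits

variable {n r : ℕ}

/-! ### The slack function -/

/-- **The slack function of the archimedean covolume clause**:
`Yslack c_K n r = (16(n+1))ʳ·(2^{n+21})ʳ·2^{n+20}·(n−r)! / ((r!)³·nʳ·(n+1)!·(n+2)^{4r}·c_K)`.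
[cite: Nesterenko2003, §5.2 (5.21)–(5.22); shape only] -/
def Yslack (cK : ℝ) (n r : ℕ) : ℝ :=
  (16 * ((n : ℝ) + 1)) ^ r * ((2 : ℝ) ^ (n + 21)) ^ r * 2 ^ (n + 20) * (((n - r)! : ℕ) : ℝ) /
    ((((r)! : ℕ) : ℝ) ^ 3 * (n : ℝ) ^ r * (((n + 1)! : ℕ) : ℝ) * ((n : ℝ) + 2) ^ (4 * r) * cK)

/-- `0 < Yslack c_K n r` for `c_K > 0`, `n ≥ 1`. [folklore] -/
theorem Yslack_pos {cK : ℝ} (hcK : 0 < cK) (hn : 1 ≤ n) (r : ℕ) : 0 < Yslack cK n r := by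
  unfold Yslack
  have h1 : (0 : ℝ) < ((r ! : ℕ) : ℝ) := by exact_mod_cast Nat.factorial_pos r
  have h2 : (0 : ℝ) < (((n - r)! : ℕ) : ℝ) := by exact_mod_cast Nat.factorial_pos _
  have h3 : (0 : ℝ) < (((n + 1)! : ℕ) : ℝ) := by exact_mod_cast Nat.factorial_pos _
  have h4 : (0 : ℝ) < (n : ℝ) := by exact_mod_cast hn
  positivity
/-! ### The four scalar comparisons (subtraction-free parametrisation `r = s+1`, `n = s+2+t`) -/

section Keys

variable (s t : ℕ) {ρ u X cK Ω : ℝ} {S₀ Xf D₀ : ℕ}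

/-- The `Y`-term of the clause with the exit right-hand side, unfolded:
`(r!)²nʳ·Yslack·((n+1)!2ⁿD₀) = (16(n+1))ʳ(2^{n+21})ʳ2^{n+20}(n−r)!·2ⁿ·D₀/(r!·(n+2)^{4r}·c_K)`. [folklore] -/
theorem core_eq (hcK : 0 < cK) :
    (((s + 1)! : ℕ) : ℝ) ^ 2 * ((s : ℝ) + 2 + t) ^ (s + 1) * Yslack cK (s + 2 + t) (s + 1) *
        ((((s + 2 + t + 1)! : ℕ) : ℝ) * 2 ^ (s + 2 + t) * (D₀ : ℝ)) =
      (16 * ((s : ℝ) + 2 + t + 1)) ^ (s + 1) * ((2 : ℝ) ^ (s + 2 + t + 21)) ^ (s + 1) * 2 ^ (s + 2 + t + 20) *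
        (((t + 1)! : ℕ) : ℝ) * 2 ^ (s + 2 + t) * (D₀ : ℝ) /
        ((((s + 1)! : ℕ) : ℝ) * ((s : ℝ) + 2 + t + 2) ^ (4 * (s + 1)) * cK) := by
  have hF : (0 : ℝ) < (((s + 1)! : ℕ) : ℝ) := by exact_mod_cast Nat.factorial_pos _
  have hG : (0 : ℝ) < (((s + 2 + t + 1)! : ℕ) : ℝ) := by exact_mod_cast Nat.factorial_pos _
  have hm : (0 : ℝ) < (s : ℝ) + 2 + t := by positivity
  have hnr : s + 2 + t - (s + 1) = t + 1 := by omega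
  unfold Yslack
  rw [hnr]
  push_cast
  field_simp

/-- **LIGHT selection, `d₀ = 0`** (the defining case of `Yslack`, an identity up to the three lower bounds
`C(S₀+r,r) ≥ (S₀+1)ʳ/r!`, `S₀+1 ≥ 16(n+1)L/(n+2)⁴`, `2X_f+1 ≥ 2^{n+23}X` and `D₀ ≤ 8X·c_K·Ω`; box scale `L = 2^{n+22}u`,
`2ρ ≤ u`): `(r!)²nʳ·Y·(n+1)!2ⁿD₀·(2ρ)ʳ ≤ C(S₀+r,r)·(2X_f+1)·(n−r)!·2^{n−r}·Ω`. [cite: Nesterenko2003, §5.2 (5.13), (5.21)] -/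
theorem keyL0 (hcK : 0 < cK) (hρ0 : 0 ≤ ρ) (hρu : 2 * ρ ≤ u) (hX : 0 ≤ X) (hΩ : 0 ≤ Ω)
    (hD₀Ω : (D₀ : ℝ) ≤ 8 * X * cK * Ω)
    (hs : (16 : ℝ) * ((s : ℝ) + 2 + t + 1) * (2 ^ (s + 2 + t + 22) * u) ≤ ((S₀ : ℝ) + 1) * ((s : ℝ) + 2 + t + 2) ^ 4)
    (hxf : (2 : ℝ) ^ (s + 2 + t + 23) * X ≤ 2 * (Xf : ℝ) + 1) :
    (((s + 1)! : ℕ) : ℝ) ^ 2 * ((s : ℝ) + 2 + t) ^ (s + 1) * Yslack cK (s + 2 + t) (s + 1) *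
        ((((s + 2 + t + 1)! : ℕ) : ℝ) * 2 ^ (s + 2 + t) * (D₀ : ℝ)) * (2 * ρ) ^ (s + 1) ≤
      ((Nat.choose (S₀ + (s + 1)) (s + 1) : ℕ) : ℝ) * (2 * (Xf : ℝ) + 1) *
        ((((t + 1)! : ℕ) : ℝ) * 2 ^ (t + 1)) * Ω := by
  have hF : (0 : ℝ) < (((s + 1)! : ℕ) : ℝ) := by exact_mod_cast Nat.factorial_pos _
  have hH : (0 : ℝ) < (((t + 1)! : ℕ) : ℝ) := by exact_mod_cast Nat.factorial_pos _
  have hm : (0 : ℝ) < (s : ℝ) + 2 + t := by positivity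
  have hu : 0 ≤ u := by linarith
  rw [core_eq s t hcK]
  -- the `Y`-side, as a product `Q · D₀ · (2ρ)^{s+1}`
  set Q : ℝ := (16 * ((s : ℝ) + 2 + t + 1)) ^ (s + 1) * ((2 : ℝ) ^ (s + 2 + t + 21)) ^ (s + 1) *
      2 ^ (s + 2 + t + 20) * (((t + 1)! : ℕ) : ℝ) * 2 ^ (s + 2 + t) /
      ((((s + 1)! : ℕ) : ℝ) * ((s : ℝ) + 2 + t + 2) ^ (4 * (s + 1)) * cK) with hQ
  have hQ0 : 0 ≤ Q := by rw [hQ]; positivity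
  have e1 : (16 * ((s : ℝ) + 2 + t + 1)) ^ (s + 1) * ((2 : ℝ) ^ (s + 2 + t + 21)) ^ (s + 1) *
        2 ^ (s + 2 + t + 20) * (((t + 1)! : ℕ) : ℝ) * 2 ^ (s + 2 + t) * (D₀ : ℝ) /
        ((((s + 1)! : ℕ) : ℝ) * ((s : ℝ) + 2 + t + 2) ^ (4 * (s + 1)) * cK) = Q * D₀ := by
    rw [hQ]; field_simp
  rw [e1]
  -- substitute `D₀ ≤ 8X c_K Ω` and `(2ρ)^{s+1} ≤ u^{s+1}`
  have hpow : (2 * ρ) ^ (s + 1) ≤ u ^ (s + 1) := pow_le_pow_left₀ (by positivity) hρu _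
  have step1 : Q * D₀ * (2 * ρ) ^ (s + 1) ≤ Q * (8 * X * cK * Ω) * u ^ (s + 1) :=
    mul_le_mul (mul_le_mul_of_nonneg_left hD₀Ω hQ0) hpow (by positivity) (by positivity)
  refine step1.trans ?_
  -- the identity: this equals `(16(n+1)L)^{s+1}/((n+2)^{4(s+1)}·(s+1)!) · 2^{n+23}X · (t+1)!·2^{t+1} · Ω`
  have e2 : Q * (8 * X * cK * Ω) * u ^ (s + 1) =
      (16 * ((s : ℝ) + 2 + t + 1)) ^ (s + 1) * (2 ^ (s + 2 + t + 22) * u) ^ (s + 1) /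
          (((s : ℝ) + 2 + t + 2) ^ (4 * (s + 1)) * (((s + 1)! : ℕ) : ℝ)) *
        (2 ^ (s + 2 + t + 23) * X) * ((((t + 1)! : ℕ) : ℝ) * 2 ^ (t + 1)) * Ω := by
    have hsplit : ((2 : ℝ) ^ (s + 2 + t + 22) * u) ^ (s + 1) =
        2 ^ (s + 1) * ((2 : ℝ) ^ (s + 2 + t + 21)) ^ (s + 1) * u ^ (s + 1) := by
      rw [← mul_pow, ← mul_pow]; congr 1; ring
    rw [hQ, hsplit]
    field_simp
    ring
  rw [e2]
  -- the three lower bounds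
  have hsP : (16 * ((s : ℝ) + 2 + t + 1)) ^ (s + 1) * (2 ^ (s + 2 + t + 22) * u) ^ (s + 1) ≤
      (((S₀ : ℝ) + 1) * ((s : ℝ) + 2 + t + 2) ^ 4) ^ (s + 1) := by
    rw [← mul_pow]; exact pow_le_pow_left₀ (by positivity) hs _
  have hch : ((S₀ : ℝ) + 1) ^ (s + 1) ≤ (((s + 1)! : ℕ) : ℝ) * ((Nat.choose (S₀ + (s + 1)) (s + 1) : ℕ) : ℝ) :=
    RecordExitsNumeric.pow_le_factorial_mul_choose_real S₀ (s + 1)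
  have h1 : (16 * ((s : ℝ) + 2 + t + 1)) ^ (s + 1) * (2 ^ (s + 2 + t + 22) * u) ^ (s + 1) /
        (((s : ℝ) + 2 + t + 2) ^ (4 * (s + 1)) * (((s + 1)! : ℕ) : ℝ)) ≤
      ((Nat.choose (S₀ + (s + 1)) (s + 1) : ℕ) : ℝ) := by
    rw [div_le_iff₀ (by positivity)]
    calc (16 * ((s : ℝ) + 2 + t + 1)) ^ (s + 1) * (2 ^ (s + 2 + t + 22) * u) ^ (s + 1)
        ≤ (((S₀ : ℝ) + 1) * ((s : ℝ) + 2 + t + 2) ^ 4) ^ (s + 1) := hsP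
      _ = ((S₀ : ℝ) + 1) ^ (s + 1) * ((s : ℝ) + 2 + t + 2) ^ (4 * (s + 1)) := by rw [mul_pow, ← pow_mul]
      _ ≤ ((((s + 1)! : ℕ) : ℝ) * ((Nat.choose (S₀ + (s + 1)) (s + 1) : ℕ) : ℝ)) *
            ((s : ℝ) + 2 + t + 2) ^ (4 * (s + 1)) := mul_le_mul_of_nonneg_right hch (by positivity)
      _ = ((Nat.choose (S₀ + (s + 1)) (s + 1) : ℕ) : ℝ) *
            (((s : ℝ) + 2 + t + 2) ^ (4 * (s + 1)) * (((s + 1)! : ℕ) : ℝ)) := by ring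
  gcongr

/-- **LIGHT selection, `d₀ = 1`** (margin `3r(n−r+1)(n+2)⁴/4`; `Ω` absorbs one box scale through the END floor of the
range `3(n+1)L ≤ 2c_K·X·Ω`): `(r!)²nʳ·Y·(n+1)!2ⁿD₀·(2ρ)ʳ ≤ C(S₀+r−1,r−1)·(2X_f+1)·(n−r+1)!·2^{n−r}·D₀·Ω`.
[cite: Nesterenko2003, §5.2 (5.13), (5.21)] -/
theorem keyL1 (hcK : 0 < cK) (hρ0 : 0 ≤ ρ) (hρu : 2 * ρ ≤ u) (hΩ : 0 ≤ Ω)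
    (hLX : 3 * ((s : ℝ) + 2 + t + 1) * (2 ^ (s + 2 + t + 22) * u) ≤ 2 * cK * X * Ω)
    (hs : (16 : ℝ) * ((s : ℝ) + 2 + t + 1) * (2 ^ (s + 2 + t + 22) * u) ≤ ((S₀ : ℝ) + 1) * ((s : ℝ) + 2 + t + 2) ^ 4)
    (hxf : (2 : ℝ) ^ (s + 2 + t + 23) * X ≤ 2 * (Xf : ℝ) + 1) :
    (((s + 1)! : ℕ) : ℝ) ^ 2 * ((s : ℝ) + 2 + t) ^ (s + 1) * Yslack cK (s + 2 + t) (s + 1) *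
        ((((s + 2 + t + 1)! : ℕ) : ℝ) * 2 ^ (s + 2 + t) * (D₀ : ℝ)) * (2 * ρ) ^ (s + 1) ≤
      ((Nat.choose (S₀ + s) s : ℕ) : ℝ) * (2 * (Xf : ℝ) + 1) *
        ((((t + 2)! : ℕ) : ℝ) * 2 ^ (t + 1) * (D₀ : ℝ)) * Ω := by
  have hF : (0 : ℝ) < (((s + 1)! : ℕ) : ℝ) := by exact_mod_cast Nat.factorial_pos _
  have hF' : (0 : ℝ) < ((s ! : ℕ) : ℝ) := by exact_mod_cast Nat.factorial_pos _
  have hH : (0 : ℝ) < (((t + 1)! : ℕ) : ℝ) := by exact_mod_cast Nat.factorial_pos _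
  have hm : (0 : ℝ) < (s : ℝ) + 2 + t := by positivity
  have hu : 0 ≤ u := by linarith
  have hfacF : (((s + 1)! : ℕ) : ℝ) = ((s : ℝ) + 1) * ((s ! : ℕ) : ℝ) := by
    rw [Nat.factorial_succ]; push_cast; ring
  have hfacH : (((t + 2)! : ℕ) : ℝ) = ((t : ℝ) + 2) * (((t + 1)! : ℕ) : ℝ) := by
    rw [show t + 2 = (t + 1) + 1 by ring, Nat.factorial_succ]; push_cast; ring
  rw [core_eq s t hcK]
  set Q : ℝ := (16 * ((s : ℝ) + 2 + t + 1)) ^ (s + 1) * ((2 : ℝ) ^ (s + 2 + t + 21)) ^ (s + 1) *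
      2 ^ (s + 2 + t + 20) * (((t + 1)! : ℕ) : ℝ) * 2 ^ (s + 2 + t) /
      ((((s + 1)! : ℕ) : ℝ) * ((s : ℝ) + 2 + t + 2) ^ (4 * (s + 1)) * cK) with hQ
  have hQ0 : 0 ≤ Q := by rw [hQ]; positivity
  have e1 : (16 * ((s : ℝ) + 2 + t + 1)) ^ (s + 1) * ((2 : ℝ) ^ (s + 2 + t + 21)) ^ (s + 1) *
        2 ^ (s + 2 + t + 20) * (((t + 1)! : ℕ) : ℝ) * 2 ^ (s + 2 + t) * (D₀ : ℝ) /
        ((((s + 1)! : ℕ) : ℝ) * ((s : ℝ) + 2 + t + 2) ^ (4 * (s + 1)) * cK) = Q * D₀ := by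
    rw [hQ]; field_simp
  rw [e1]
  have hpow : (2 * ρ) ^ (s + 1) ≤ u ^ (s + 1) := pow_le_pow_left₀ (by positivity) hρu _
  have step1 : Q * D₀ * (2 * ρ) ^ (s + 1) ≤ Q * D₀ * u ^ (s + 1) :=
    mul_le_mul_of_nonneg_left hpow (by positivity)
  refine step1.trans ?_
  -- the margin `3(s+1)(t+2)(n+2)⁴/4 ≥ 1`
  have hmargin : (1 : ℝ) ≤ 3 * ((s : ℝ) + 1) * ((t : ℝ) + 2) * ((s : ℝ) + 2 + t + 2) ^ 4 / 4 := by
    rw [le_div_iff₀ (by norm_num)]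
    have h4 : (1 : ℝ) ≤ ((s : ℝ) + 2 + t + 2) ^ 4 := one_le_pow₀ (by linarith)
    have hs0 : (0 : ℝ) ≤ s := Nat.cast_nonneg s
    have ht0 : (0 : ℝ) ≤ t := Nat.cast_nonneg t
    have h5 : (2 : ℝ) ≤ ((s : ℝ) + 1) * ((t : ℝ) + 2) := by nlinarith
    have h6 : (2 : ℝ) * 1 ≤ ((s : ℝ) + 1) * ((t : ℝ) + 2) * ((s : ℝ) + 2 + t + 2) ^ 4 :=
      mul_le_mul h5 h4 zero_le_one (by positivity)
    have e : 3 * ((s : ℝ) + 1) * ((t : ℝ) + 2) * ((s : ℝ) + 2 + t + 2) ^ 4 =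
        3 * (((s : ℝ) + 1) * ((t : ℝ) + 2) * ((s : ℝ) + 2 + t + 2) ^ 4) := by ring
    rw [e]; linarith
  have step2 : Q * D₀ * u ^ (s + 1) ≤
      Q * D₀ * u ^ (s + 1) * (3 * ((s : ℝ) + 1) * ((t : ℝ) + 2) * ((s : ℝ) + 2 + t + 2) ^ 4 / 4) :=
    le_mul_of_one_le_right (by positivity) hmargin
  refine step2.trans ?_
  -- the identity
  have hsplit : ((2 : ℝ) ^ (s + 2 + t + 22) * u) ^ s = 2 ^ s * ((2 : ℝ) ^ (s + 2 + t + 21)) ^ s * u ^ s := by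
    rw [← mul_pow, ← mul_pow]; congr 1; ring
  have e2 : Q * D₀ * u ^ (s + 1) * (3 * ((s : ℝ) + 1) * ((t : ℝ) + 2) * ((s : ℝ) + 2 + t + 2) ^ 4 / 4) =
      (16 * ((s : ℝ) + 2 + t + 1)) ^ s * (2 ^ (s + 2 + t + 22) * u) ^ s /
          (((s : ℝ) + 2 + t + 2) ^ (4 * s) * ((s ! : ℕ) : ℝ)) *
        2 ^ (s + 2 + t + 23) * (((t : ℝ) + 2) * (((t + 1)! : ℕ) : ℝ) * 2 ^ (t + 1) * (D₀ : ℝ)) *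
        (3 * ((s : ℝ) + 2 + t + 1) * (2 ^ (s + 2 + t + 22) * u) / (2 * cK)) := by
    rw [hQ, hsplit, hfacF]
    field_simp
    ring
  rw [e2]
  -- the lower bounds
  have hsP : (16 * ((s : ℝ) + 2 + t + 1)) ^ s * (2 ^ (s + 2 + t + 22) * u) ^ s ≤
      (((S₀ : ℝ) + 1) * ((s : ℝ) + 2 + t + 2) ^ 4) ^ s := by
    rw [← mul_pow]; exact pow_le_pow_left₀ (by positivity) hs _
  have hch : ((S₀ : ℝ) + 1) ^ s ≤ ((s ! : ℕ) : ℝ) * ((Nat.choose (S₀ + s) s : ℕ) : ℝ) :=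
    RecordExitsNumeric.pow_le_factorial_mul_choose_real S₀ s
  have h1 : (16 * ((s : ℝ) + 2 + t + 1)) ^ s * (2 ^ (s + 2 + t + 22) * u) ^ s /
        (((s : ℝ) + 2 + t + 2) ^ (4 * s) * ((s ! : ℕ) : ℝ)) ≤ ((Nat.choose (S₀ + s) s : ℕ) : ℝ) := by
    rw [div_le_iff₀ (by positivity)]
    calc (16 * ((s : ℝ) + 2 + t + 1)) ^ s * (2 ^ (s + 2 + t + 22) * u) ^ s
        ≤ (((S₀ : ℝ) + 1) * ((s : ℝ) + 2 + t + 2) ^ 4) ^ s := hsP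
      _ = ((S₀ : ℝ) + 1) ^ s * ((s : ℝ) + 2 + t + 2) ^ (4 * s) := by rw [mul_pow, ← pow_mul]
      _ ≤ (((s ! : ℕ) : ℝ) * ((Nat.choose (S₀ + s) s : ℕ) : ℝ)) * ((s : ℝ) + 2 + t + 2) ^ (4 * s) :=
          mul_le_mul_of_nonneg_right hch (by positivity)
      _ = ((Nat.choose (S₀ + s) s : ℕ) : ℝ) * (((s : ℝ) + 2 + t + 2) ^ (4 * s) * ((s ! : ℕ) : ℝ)) := by ring
  have h2 : 3 * ((s : ℝ) + 2 + t + 1) * (2 ^ (s + 2 + t + 22) * u) / (2 * cK) ≤ X * Ω := by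
    rw [div_le_iff₀ (by positivity)]; linarith
  calc (16 * ((s : ℝ) + 2 + t + 1)) ^ s * (2 ^ (s + 2 + t + 22) * u) ^ s /
          (((s : ℝ) + 2 + t + 2) ^ (4 * s) * ((s ! : ℕ) : ℝ)) *
        2 ^ (s + 2 + t + 23) * (((t : ℝ) + 2) * (((t + 1)! : ℕ) : ℝ) * 2 ^ (t + 1) * (D₀ : ℝ)) *
        (3 * ((s : ℝ) + 2 + t + 1) * (2 ^ (s + 2 + t + 22) * u) / (2 * cK))
      ≤ ((Nat.choose (S₀ + s) s : ℕ) : ℝ) *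
        2 ^ (s + 2 + t + 23) * (((t : ℝ) + 2) * (((t + 1)! : ℕ) : ℝ) * 2 ^ (t + 1) * (D₀ : ℝ)) * (X * Ω) := by
        gcongr
    _ = ((Nat.choose (S₀ + s) s : ℕ) : ℝ) * (2 ^ (s + 2 + t + 23) * X) *
        ((((t + 2)! : ℕ) : ℝ) * 2 ^ (t + 1) * (D₀ : ℝ)) * Ω := by rw [hfacH]; ring
    _ ≤ ((Nat.choose (S₀ + s) s : ℕ) : ℝ) * (2 * (Xf : ℝ) + 1) *
        ((((t + 2)! : ℕ) : ℝ) * 2 ^ (t + 1) * (D₀ : ℝ)) * Ω := by gcongr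

/-- **HEAVY selection, `d₀ = 1`** (`Ω` and `D₀` cancel; margin `X·r(n−r+1)(n+2)⁴·c_K/((n+1)·2^{n+23}) ≥ 2r(n−r+1)(n+2)⁴`
from `X ≥ 64(n+1)`, `c_K ≥ 2^{n+18}`): `(r!)²nʳ·Y·(n+1)!2ⁿD₀·(2ρ)^{r−1} ≤ C(S₀+r−1,r−1)·(2X_f+1)·(n−r+1)!·2^{n−r}·D₀`.
[cite: Nesterenko2003, §5.2 (5.13), (5.21)] -/
theorem keyH1 (hcK : (2 : ℝ) ^ (s + 2 + t + 18) ≤ cK) (hρ0 : 0 ≤ ρ) (hρu : 2 * ρ ≤ u)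
    (hX : 64 * ((s : ℝ) + 2 + t + 1) ≤ X)
    (hs : (16 : ℝ) * ((s : ℝ) + 2 + t + 1) * (2 ^ (s + 2 + t + 22) * u) ≤ ((S₀ : ℝ) + 1) * ((s : ℝ) + 2 + t + 2) ^ 4)
    (hxf : (2 : ℝ) ^ (s + 2 + t + 23) * X ≤ 2 * (Xf : ℝ) + 1) :
    (((s + 1)! : ℕ) : ℝ) ^ 2 * ((s : ℝ) + 2 + t) ^ (s + 1) * Yslack cK (s + 2 + t) (s + 1) *
        ((((s + 2 + t + 1)! : ℕ) : ℝ) * 2 ^ (s + 2 + t) * (D₀ : ℝ)) * (2 * ρ) ^ s ≤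
      ((Nat.choose (S₀ + s) s : ℕ) : ℝ) * (2 * (Xf : ℝ) + 1) *
        ((((t + 2)! : ℕ) : ℝ) * 2 ^ (t + 1) * (D₀ : ℝ)) := by
  have hcK0 : 0 < cK := lt_of_lt_of_le (by positivity) hcK
  have hX0 : 0 ≤ X := le_trans (by positivity) hX
  have hF : (0 : ℝ) < (((s + 1)! : ℕ) : ℝ) := by exact_mod_cast Nat.factorial_pos _
  have hF' : (0 : ℝ) < ((s ! : ℕ) : ℝ) := by exact_mod_cast Nat.factorial_pos _
  have hH : (0 : ℝ) < (((t + 1)! : ℕ) : ℝ) := by exact_mod_cast Nat.factorial_pos _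
  have hm : (0 : ℝ) < (s : ℝ) + 2 + t := by positivity
  have hu : 0 ≤ u := by linarith
  have hfacF : (((s + 1)! : ℕ) : ℝ) = ((s : ℝ) + 1) * ((s ! : ℕ) : ℝ) := by
    rw [Nat.factorial_succ]; push_cast; ring
  have hfacH : (((t + 2)! : ℕ) : ℝ) = ((t : ℝ) + 2) * (((t + 1)! : ℕ) : ℝ) := by
    rw [show t + 2 = (t + 1) + 1 by ring, Nat.factorial_succ]; push_cast; ring
  rw [core_eq s t hcK0]
  set Q : ℝ := (16 * ((s : ℝ) + 2 + t + 1)) ^ (s + 1) * ((2 : ℝ) ^ (s + 2 + t + 21)) ^ (s + 1) *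
      2 ^ (s + 2 + t + 20) * (((t + 1)! : ℕ) : ℝ) * 2 ^ (s + 2 + t) /
      ((((s + 1)! : ℕ) : ℝ) * ((s : ℝ) + 2 + t + 2) ^ (4 * (s + 1)) * cK) with hQ
  have hQ0 : 0 ≤ Q := by rw [hQ]; positivity
  have e1 : (16 * ((s : ℝ) + 2 + t + 1)) ^ (s + 1) * ((2 : ℝ) ^ (s + 2 + t + 21)) ^ (s + 1) *
        2 ^ (s + 2 + t + 20) * (((t + 1)! : ℕ) : ℝ) * 2 ^ (s + 2 + t) * (D₀ : ℝ) /
        ((((s + 1)! : ℕ) : ℝ) * ((s : ℝ) + 2 + t + 2) ^ (4 * (s + 1)) * cK) = Q * D₀ := by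
    rw [hQ]; field_simp
  rw [e1]
  have hpow : (2 * ρ) ^ s ≤ u ^ s := pow_le_pow_left₀ (by positivity) hρu _
  have step1 : Q * D₀ * (2 * ρ) ^ s ≤ Q * D₀ * u ^ s := mul_le_mul_of_nonneg_left hpow (by positivity)
  refine step1.trans ?_
  -- the margin `X(s+1)(t+2)(n+2)⁴ c_K/((n+1) 2^{n+23}) ≥ 1`
  have hmargin : (1 : ℝ) ≤ X * (((s : ℝ) + 1) * ((t : ℝ) + 2) * ((s : ℝ) + 2 + t + 2) ^ 4) * cK /
      (((s : ℝ) + 2 + t + 1) * 2 ^ (s + 2 + t + 23)) := by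
    rw [le_div_iff₀ (by positivity), one_mul]
    have h4 : (1 : ℝ) ≤ ((s : ℝ) + 1) * ((t : ℝ) + 2) * ((s : ℝ) + 2 + t + 2) ^ 4 := by
      have h4' : (1 : ℝ) ≤ ((s : ℝ) + 2 + t + 2) ^ 4 := one_le_pow₀ (by linarith)
      have hs0 : (0 : ℝ) ≤ s := Nat.cast_nonneg s
      have ht0 : (0 : ℝ) ≤ t := Nat.cast_nonneg t
      have h5 : (1 : ℝ) ≤ ((s : ℝ) + 1) * ((t : ℝ) + 2) := by nlinarith
      exact one_le_mul_of_one_le_of_one_le h5 h4'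
    have e : ((s : ℝ) + 2 + t + 1) * 2 ^ (s + 2 + t + 23) = (64 * ((s : ℝ) + 2 + t + 1)) * 1 * (2 ^ (s + 2 + t + 18) / 2) := by
      ring
    rw [e]
    have hcK' : (2 : ℝ) ^ (s + 2 + t + 18) / 2 ≤ cK := by
      have : (0 : ℝ) ≤ 2 ^ (s + 2 + t + 18) := by positivity
      linarith
    exact mul_le_mul (mul_le_mul hX h4 (by norm_num) hX0) hcK' (by positivity) (by positivity)
  have step2 : Q * D₀ * u ^ s ≤ Q * D₀ * u ^ s * (X * (((s : ℝ) + 1) * ((t : ℝ) + 2) * ((s : ℝ) + 2 + t + 2) ^ 4) * cK /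
      (((s : ℝ) + 2 + t + 1) * 2 ^ (s + 2 + t + 23))) := le_mul_of_one_le_right (by positivity) hmargin
  refine step2.trans ?_
  have hsplit : ((2 : ℝ) ^ (s + 2 + t + 22) * u) ^ s = 2 ^ s * ((2 : ℝ) ^ (s + 2 + t + 21)) ^ s * u ^ s := by
    rw [← mul_pow, ← mul_pow]; congr 1; ring
  have e2 : Q * D₀ * u ^ s * (X * (((s : ℝ) + 1) * ((t : ℝ) + 2) * ((s : ℝ) + 2 + t + 2) ^ 4) * cK /
      (((s : ℝ) + 2 + t + 1) * 2 ^ (s + 2 + t + 23))) =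
      (16 * ((s : ℝ) + 2 + t + 1)) ^ s * (2 ^ (s + 2 + t + 22) * u) ^ s /
          (((s : ℝ) + 2 + t + 2) ^ (4 * s) * ((s ! : ℕ) : ℝ)) *
        (2 ^ (s + 2 + t + 23) * X) * (((t : ℝ) + 2) * (((t + 1)! : ℕ) : ℝ) * 2 ^ (t + 1) * (D₀ : ℝ)) := by
    rw [hQ, hsplit, hfacF]
    field_simp
    ring
  rw [e2]
  have hsP : (16 * ((s : ℝ) + 2 + t + 1)) ^ s * (2 ^ (s + 2 + t + 22) * u) ^ s ≤
      (((S₀ : ℝ) + 1) * ((s : ℝ) + 2 + t + 2) ^ 4) ^ s := by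
    rw [← mul_pow]; exact pow_le_pow_left₀ (by positivity) hs _
  have hch : ((S₀ : ℝ) + 1) ^ s ≤ ((s ! : ℕ) : ℝ) * ((Nat.choose (S₀ + s) s : ℕ) : ℝ) :=
    RecordExitsNumeric.pow_le_factorial_mul_choose_real S₀ s
  have h1 : (16 * ((s : ℝ) + 2 + t + 1)) ^ s * (2 ^ (s + 2 + t + 22) * u) ^ s /
        (((s : ℝ) + 2 + t + 2) ^ (4 * s) * ((s ! : ℕ) : ℝ)) ≤ ((Nat.choose (S₀ + s) s : ℕ) : ℝ) := by
    rw [div_le_iff₀ (by positivity)]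
    calc (16 * ((s : ℝ) + 2 + t + 1)) ^ s * (2 ^ (s + 2 + t + 22) * u) ^ s
        ≤ (((S₀ : ℝ) + 1) * ((s : ℝ) + 2 + t + 2) ^ 4) ^ s := hsP
      _ = ((S₀ : ℝ) + 1) ^ s * ((s : ℝ) + 2 + t + 2) ^ (4 * s) := by rw [mul_pow, ← pow_mul]
      _ ≤ (((s ! : ℕ) : ℝ) * ((Nat.choose (S₀ + s) s : ℕ) : ℝ)) * ((s : ℝ) + 2 + t + 2) ^ (4 * s) :=
          mul_le_mul_of_nonneg_right hch (by positivity)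
      _ = ((Nat.choose (S₀ + s) s : ℕ) : ℝ) * (((s : ℝ) + 2 + t + 2) ^ (4 * s) * ((s ! : ℕ) : ℝ)) := by ring
  calc (16 * ((s : ℝ) + 2 + t + 1)) ^ s * (2 ^ (s + 2 + t + 22) * u) ^ s /
          (((s : ℝ) + 2 + t + 2) ^ (4 * s) * ((s ! : ℕ) : ℝ)) *
        (2 ^ (s + 2 + t + 23) * X) * (((t : ℝ) + 2) * (((t + 1)! : ℕ) : ℝ) * 2 ^ (t + 1) * (D₀ : ℝ))
      ≤ ((Nat.choose (S₀ + s) s : ℕ) : ℝ) * (2 * (Xf : ℝ) + 1) *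
        (((t : ℝ) + 2) * (((t + 1)! : ℕ) : ℝ) * 2 ^ (t + 1) * (D₀ : ℝ)) := by gcongr
    _ = ((Nat.choose (S₀ + s) s : ℕ) : ℝ) * (2 * (Xf : ℝ) + 1) *
        ((((t + 2)! : ℕ) : ℝ) * 2 ^ (t + 1) * (D₀ : ℝ)) := by rw [hfacH]

/-- **HEAVY selection, `d₀ = 0`** (`Ω` cancels; `D₀ ≤ XL/2`; margin `c_K/2^{n+18}`):
`(r!)²nʳ·Y·(n+1)!2ⁿD₀·(2ρ)^{r−1} ≤ C(S₀+r,r)·(2X_f+1)·(n−r)!·2^{n−r}`. [cite: Nesterenko2003, §5.2 (5.13), (5.21)] -/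
theorem keyH0 (hcK : (2 : ℝ) ^ (s + 2 + t + 18) ≤ cK) (hρ0 : 0 ≤ ρ) (hρu : 2 * ρ ≤ u) (hX : 0 ≤ X)
    (hD₀half : (D₀ : ℝ) ≤ X * (2 ^ (s + 2 + t + 22) * u) / 2)
    (hs : (16 : ℝ) * ((s : ℝ) + 2 + t + 1) * (2 ^ (s + 2 + t + 22) * u) ≤ ((S₀ : ℝ) + 1) * ((s : ℝ) + 2 + t + 2) ^ 4)
    (hxf : (2 : ℝ) ^ (s + 2 + t + 23) * X ≤ 2 * (Xf : ℝ) + 1) :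
    (((s + 1)! : ℕ) : ℝ) ^ 2 * ((s : ℝ) + 2 + t) ^ (s + 1) * Yslack cK (s + 2 + t) (s + 1) *
        ((((s + 2 + t + 1)! : ℕ) : ℝ) * 2 ^ (s + 2 + t) * (D₀ : ℝ)) * (2 * ρ) ^ s ≤
      ((Nat.choose (S₀ + (s + 1)) (s + 1) : ℕ) : ℝ) * (2 * (Xf : ℝ) + 1) *
        ((((t + 1)! : ℕ) : ℝ) * 2 ^ (t + 1)) := by
  have hcK0 : 0 < cK := lt_of_lt_of_le (by positivity) hcK
  have hF : (0 : ℝ) < (((s + 1)! : ℕ) : ℝ) := by exact_mod_cast Nat.factorial_pos _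
  have hH : (0 : ℝ) < (((t + 1)! : ℕ) : ℝ) := by exact_mod_cast Nat.factorial_pos _
  have hm : (0 : ℝ) < (s : ℝ) + 2 + t := by positivity
  have hu : 0 ≤ u := by linarith
  rw [core_eq s t hcK0]
  set Q : ℝ := (16 * ((s : ℝ) + 2 + t + 1)) ^ (s + 1) * ((2 : ℝ) ^ (s + 2 + t + 21)) ^ (s + 1) *
      2 ^ (s + 2 + t + 20) * (((t + 1)! : ℕ) : ℝ) * 2 ^ (s + 2 + t) /
      ((((s + 1)! : ℕ) : ℝ) * ((s : ℝ) + 2 + t + 2) ^ (4 * (s + 1)) * cK) with hQ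
  have hQ0 : 0 ≤ Q := by rw [hQ]; positivity
  have e1 : (16 * ((s : ℝ) + 2 + t + 1)) ^ (s + 1) * ((2 : ℝ) ^ (s + 2 + t + 21)) ^ (s + 1) *
        2 ^ (s + 2 + t + 20) * (((t + 1)! : ℕ) : ℝ) * 2 ^ (s + 2 + t) * (D₀ : ℝ) /
        ((((s + 1)! : ℕ) : ℝ) * ((s : ℝ) + 2 + t + 2) ^ (4 * (s + 1)) * cK) = Q * D₀ := by
    rw [hQ]; field_simp
  rw [e1]
  have hpow : (2 * ρ) ^ s ≤ u ^ s := pow_le_pow_left₀ (by positivity) hρu _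
  have step1 : Q * D₀ * (2 * ρ) ^ s ≤ Q * (X * (2 ^ (s + 2 + t + 22) * u) / 2) * u ^ s :=
    mul_le_mul (mul_le_mul_of_nonneg_left hD₀half hQ0) hpow (by positivity) (by positivity)
  refine step1.trans ?_
  have hmargin : (1 : ℝ) ≤ cK / 2 ^ (s + 2 + t + 18) := by
    rw [le_div_iff₀ (by positivity), one_mul]; exact hcK
  have step2 : Q * (X * (2 ^ (s + 2 + t + 22) * u) / 2) * u ^ s ≤
      Q * (X * (2 ^ (s + 2 + t + 22) * u) / 2) * u ^ s * (cK / 2 ^ (s + 2 + t + 18)) :=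
    le_mul_of_one_le_right (by positivity) hmargin
  refine step2.trans ?_
  have hsplit : ((2 : ℝ) ^ (s + 2 + t + 22) * u) ^ (s + 1) =
      2 ^ (s + 1) * ((2 : ℝ) ^ (s + 2 + t + 21)) ^ (s + 1) * u ^ (s + 1) := by
    rw [← mul_pow, ← mul_pow]; congr 1; ring
  have e2 : Q * (X * (2 ^ (s + 2 + t + 22) * u) / 2) * u ^ s * (cK / 2 ^ (s + 2 + t + 18)) =
      (16 * ((s : ℝ) + 2 + t + 1)) ^ (s + 1) * (2 ^ (s + 2 + t + 22) * u) ^ (s + 1) /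
          (((s : ℝ) + 2 + t + 2) ^ (4 * (s + 1)) * (((s + 1)! : ℕ) : ℝ)) *
        (2 ^ (s + 2 + t + 23) * X) * ((((t + 1)! : ℕ) : ℝ) * 2 ^ (t + 1)) := by
    rw [hQ, hsplit, show (2 : ℝ) ^ (s + 2 + t + 22) = 2 * 2 ^ (s + 2 + t + 21) by ring]
    field_simp
    ring
  rw [e2]
  have hsP : (16 * ((s : ℝ) + 2 + t + 1)) ^ (s + 1) * (2 ^ (s + 2 + t + 22) * u) ^ (s + 1) ≤
      (((S₀ : ℝ) + 1) * ((s : ℝ) + 2 + t + 2) ^ 4) ^ (s + 1) := by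
    rw [← mul_pow]; exact pow_le_pow_left₀ (by positivity) hs _
  have hch : ((S₀ : ℝ) + 1) ^ (s + 1) ≤ (((s + 1)! : ℕ) : ℝ) * ((Nat.choose (S₀ + (s + 1)) (s + 1) : ℕ) : ℝ) :=
    RecordExitsNumeric.pow_le_factorial_mul_choose_real S₀ (s + 1)
  have h1 : (16 * ((s : ℝ) + 2 + t + 1)) ^ (s + 1) * (2 ^ (s + 2 + t + 22) * u) ^ (s + 1) /
        (((s : ℝ) + 2 + t + 2) ^ (4 * (s + 1)) * (((s + 1)! : ℕ) : ℝ)) ≤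
      ((Nat.choose (S₀ + (s + 1)) (s + 1) : ℕ) : ℝ) := by
    rw [div_le_iff₀ (by positivity)]
    calc (16 * ((s : ℝ) + 2 + t + 1)) ^ (s + 1) * (2 ^ (s + 2 + t + 22) * u) ^ (s + 1)
        ≤ (((S₀ : ℝ) + 1) * ((s : ℝ) + 2 + t + 2) ^ 4) ^ (s + 1) := hsP
      _ = ((S₀ : ℝ) + 1) ^ (s + 1) * ((s : ℝ) + 2 + t + 2) ^ (4 * (s + 1)) := by rw [mul_pow, ← pow_mul]
      _ ≤ ((((s + 1)! : ℕ) : ℝ) * ((Nat.choose (S₀ + (s + 1)) (s + 1) : ℕ) : ℝ)) *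
            ((s : ℝ) + 2 + t + 2) ^ (4 * (s + 1)) := mul_le_mul_of_nonneg_right hch (by positivity)
      _ = ((Nat.choose (S₀ + (s + 1)) (s + 1) : ℕ) : ℝ) *
            (((s : ℝ) + 2 + t + 2) ^ (4 * (s + 1)) * (((s + 1)! : ℕ) : ℝ)) := by ring
  gcongr

end Keys

end Summit.ABC.StewartYu.RecordExits

end
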